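import Summits.ResolutionOfSingularities.ResolutionOfSingularities.Theorems.RadicialJungCleanModelsStubCjs2020Cor15
import Summits.ResolutionOfSingularities.ResolutionOfSingularities.Theorems.CossartPiltant2019PatchingHolds
import Literature.AlgebraicGeometry.Resolution.ArithmeticalThreefoldsDescentHeadQuotientLU
import Literature.AlgebraicGeometry.Resolution.ArithmeticalThreefoldsAlgebraization
import Literature.AlgebraicGeometry.Resolution.ProjectiveSpaceCodimTwoReembedding
import Literature.AlgebraicGeometry.Resolution.ArithmeticalThreefoldsLocal
import HarnessLib

/-!
# `CleanModels`, stub 2 (F-02) at characteristic `p`: the geometric head of CP 2019 Prop. 4.8 DISCHARGED —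
# the leaf list is now {CP (LU) for complete 3-dim local domains of residue char `p`, stub 1, (LU) for complete local
# domains of dimension ≤ 2}

OURS (decomp-res hand-1 g19; crux `stmt-ResolutionOfSingularities-15917`, skeleton rev 35
`Cruxes/CleanModels/Lines/Sketch.lean`, stub `stub_cossartPiltant2019 : CossartPiltant2019.{0}`). A BOOKKEEPING file continuing
`RadicialJungCleanModelsStubCossartPiltant2019Leaves{,RankOne,CharP}.lean`.

Up to hand-1 g18 the `k`-instance of stub 2 at characteristic `p` (`localUniformization3_of_stub1_of_leaves_charP`) carried the
leaf `hhead` = the geometric head of Cossart–Piltant 2019 Prop. 4.8 along rank-one valuations (the regular model `𝒪_{Ŷ,ŷ}` of the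
formal branch with `K`-finite denominators + Lemma 4.7 + (510)–(512) + descent). Hand-1 g19 PROVED that head in kernel
(`Literature/AlgebraicGeometry/Resolution/ArithmeticalThreefoldsDescentHeadQuotientLU.lean`: the model is built WITHOUT patching
over `Spec Â`, by Novacoski–Spivakovsky's composite lifting along the `K`-bounded coarsening of `v̂`, whose centre `P∞` is a
regular point of the branch; the residual valuation lives on the complete local domain `Â/P∞`), modulo Cossart–Piltant's property
(LU) for the local domains that are QUOTIENTS of `B̂_𝔭`. Those quotients are complete Noetherian local domains of dimension `≤ 3`
with residue field of characteristic `p`; in dimension `3` (LU) for them is the tree's `CossartPiltant2019ReductionP` (CP 2019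
Prop. 4.10, proved from `CossartPiltant2019Local` + stub 1 + `hEqT` + `hEqI` in `ArithmeticalThreefoldsLocalDescentEmbChain6.lean`),
and in dimension `≤ 2` it is local uniformization of complete local surfaces and curves — a consequence of resolution of
excellent surfaces (Cossart–Jannsen–Saito = stub 1; normalization in dimension `1`), recorded here as the hypothesis `hLU2`.

* `localUniformization3_of_stub1_of_luComplete_charP` — `LocalUniformization3 k` (`CharP k p`) from stub 1
  (`CossartJannsenSaito2020Embedded.{0}`), (LU) for complete 3-dimensional local domains of residue characteristic `p`, and `hLU2`;
* `resolutionOverUpToDim_three_of_stub1_of_luComplete_charP` — hence `ResolutionOverUpToDim k 3` by the PROVED patching;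
* `localUniformization3_of_stub1_of_reductionP_charP` / `resolutionOverUpToDim_three_of_stub1_of_reductionP_charP` — the same with
  the dimension-3 input taken from `CossartPiltant2019Local` + `CossartPiltant2019ReductionP` (the latter proved in the tree from
  `CossartPiltant2019Local`, `CossartPiltant2019Principalization` (proved), stub 1, `hEqT`, `hEqI`).

Nothing here proves resolution of singularities in positive characteristic, local uniformization in dimension three, or any
statement of a manuscript under adjudication; rung 0. AI-written; AI review weaker than expert review.
-/

-- `Summit.<Summit>.<Sub>.Theorems` with `Sub = Summit` (single-conjunct summit, D-0017)
set_option linter.dupNamespace false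

noncomputable section

open IsLocalRing Polynomial
open Literature.AlgebraicGeometry.Resolution
open Summit.ResolutionOfSingularities.ResolutionOfSingularities.Theorems.CP2008Prop44

namespace Summit.ResolutionOfSingularities.ResolutionOfSingularities.Theorems.RadicialJung.CleanModels

/-- **(LU) for every quotient of `B̂_𝔭` from (LU) in dimension `3` (residue characteristic `p`) and in dimension `≤ 2`.** For a
field `k` of characteristic `p`, a `k`-algebra `B` of finite type (a domain) and a prime `𝔭` with `dim B_𝔭 = 3`: every local
domain `R` receiving a surjection from the completion `B̂_𝔭` is complete, Noetherian, of dimension `≤ 3`, with residue field of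
characteristic `p`; so (LU) for it follows from the two dimension-sorted inputs. [cite: CossartPiltant2019, proof of Prop. 4.8 and
Prop. 4.10 (arXiv v1: Props. 4.6, 4.8)] -/
theorem cpLocalUniformization_quotient_completion_of_luComplete (p : ℕ) [Fact p.Prime]
    (hLU3 : ∀ (A : Type) [CommRing A] [IsDomain A] [IsLocalRing A] [IsNoetherianRing A]
        [IsAdicComplete (maximalIdeal A) A],
        ringKrullDim A = 3 → CharP (ResidueField A) p → CPLocalUniformization A)
    (hLU2 : ∀ (A : Type) [CommRing A] [IsDomain A] [IsLocalRing A] [IsNoetherianRing A]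
        [IsAdicComplete (maximalIdeal A) A],
        ringKrullDim A ≤ 2 → CharP (ResidueField A) p → CPLocalUniformization A)
    (k : Type) [Field k] [CharP k p]
    (B : Type) [CommRing B] [IsDomain B] [Algebra k B] [Algebra.FiniteType k B]
    (𝔭 : Ideal B) [𝔭.IsPrime] (hdim : ringKrullDim (Localization.AtPrime 𝔭) = 3)
    (R : Type) [CommRing R] [IsDomain R] [IsLocalRing R]
    (π : AdicCompletion (maximalIdeal (Localization.AtPrime 𝔭)) (Localization.AtPrime 𝔭) →+* R)
    (hπ : Function.Surjective π) : CPLocalUniformization R := by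
  set A := Localization.AtPrime 𝔭 with hAdef
  haveI : IsNoetherianRing B := Algebra.FiniteType.isNoetherianRing k B
  haveI : IsNoetherianRing A := IsLocalization.isNoetherianRing 𝔭.primeCompl _ inferInstance
  set Ah := AdicCompletion (maximalIdeal A) A with hAhdef
  haveI : IsNoetherianRing Ah := isNoetherianRing_adicCompletion_maximalIdeal A
  haveI : IsNoetherianRing R := isNoetherianRing_of_surjective Ah R π hπ
  haveI : IsAdicComplete (maximalIdeal R) R := isAdicComplete_of_surjective π hπ
  -- residue characteristic `p`: `k → B_𝔭 → B̂_𝔭 → R → κ(R)` is a field homomorphism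
  haveI hchar : CharP (ResidueField R) p := by
    let f : k →+* ResidueField R :=
      (IsLocalRing.residue R).comp (π.comp ((algebraMap A Ah).comp (algebraMap k A)))
    exact charP_of_injective_ringHom f.injective p
  -- dimension `≤ 3`
  have hle : ringKrullDim R ≤ 3 := by
    calc ringKrullDim R ≤ ringKrullDim Ah := ringKrullDim_le_of_surjective π hπ
      _ = ringKrullDim A := ringKrullDim_adicCompletion A
      _ = 3 := hdim
  obtain ⟨n, hn⟩ := exists_ringKrullDim_eq_natCast R
  rw [hn] at hle
  have hn3 : n ≤ 3 := by exact_mod_cast hle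
  rcases Nat.lt_or_ge n 3 with hlt | hge
  · refine hLU2 R ?_ hchar
    rw [hn]; exact_mod_cast (Nat.lt_succ_iff.mp hlt)
  · refine hLU3 R ?_ hchar
    rw [hn]; exact_mod_cast le_antisymm hn3 hge

/-- **Local uniformization in dimension three over a field of characteristic `p`, from stub 1 + (LU) for complete local domains
of dimension `3` (residue characteristic `p`) and of dimension `≤ 2` — the geometric head of CP 2019 Prop. 4.8 DISCHARGED**
(hand-1 g19). Chain: `localUniformization3_of_quotientLU` (Novacoski–Spivakovsky in transcendence degree `≤ 3`, closed points,
Prop. 4.8 at rank one in kernel: `exists_adjoin_isRegularLocalRing_rankOne_of_quotientLU`) fed with surface resolution over `k`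
(`cossartJannsenSaito2020_of_embedded`), embedded resolution of surfaces in the Cor. 1.5 form (`stub_cjs2020Cor15_of_embedded`),
and `cpLocalUniformization_quotient_completion_of_luComplete`.
[cite: CossartPiltant2019, Thm. 1.5, Props. 4.8 (with Lemma 4.7), 4.10] [cite: CossartJannsenSaito2020, Thm. 1.2, Thm. 1.4, Cor. 1.5]
[cite: NovacoskiSpivakovsky2014, Thm. 1.1, Cor. 2.17, §3.1] -/
theorem localUniformization3_of_stub1_of_luComplete_charP (p : ℕ) (hp : p.Prime)
    (hCJSE : CossartJannsenSaito2020Embedded.{0})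
    (hLU3 : ∀ (A : Type) [CommRing A] [IsDomain A] [IsLocalRing A] [IsNoetherianRing A]
        [IsAdicComplete (maximalIdeal A) A],
        ringKrullDim A = 3 → CharP (ResidueField A) p → CPLocalUniformization A)
    (hLU2 : ∀ (A : Type) [CommRing A] [IsDomain A] [IsLocalRing A] [IsNoetherianRing A]
        [IsAdicComplete (maximalIdeal A) A],
        ringKrullDim A ≤ 2 → CharP (ResidueField A) p → CPLocalUniformization A)
    (k : Type) [Field k] [CharP k p] : LocalUniformization3 k :=
  haveI : Fact p.Prime := ⟨hp⟩
  localUniformization3_of_quotientLU (cossartJannsenSaito2020_of_embedded hCJSE) k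
    (stub_cjs2020Cor15_of_embedded hCJSE)
    fun B _ _ _ _ 𝔭 _ _ h2 R _ _ _ π hπ =>
      cpLocalUniformization_quotient_completion_of_luComplete p hLU3 hLU2 k B 𝔭 h2 R π hπ

/-- **Weak resolution of threefolds over a field of characteristic `p` from stub 1 + (LU) for complete local domains of
dimension `3` (residue characteristic `p`) and of dimension `≤ 2`** (hand-1 g19): `ResolutionOverUpToDim k 3`, the `k`-instance
of F-02 `CossartPiltant2019`, by the PROVED enhanced Zariski patching (`CossartPiltant2019Patching_holds`, CP 2019 Prop. 4.6) fed
with surface resolution over `k` and `localUniformization3_of_stub1_of_luComplete_charP`.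
[cite: CossartPiltant2019, Thm. 1.1, Props. 4.6, 4.8, 4.10] [cite: CossartJannsenSaito2020, Thm. 1.2, Thm. 1.4] -/
theorem resolutionOverUpToDim_three_of_stub1_of_luComplete_charP (p : ℕ) (hp : p.Prime)
    (hCJSE : CossartJannsenSaito2020Embedded.{0})
    (hLU3 : ∀ (A : Type) [CommRing A] [IsDomain A] [IsLocalRing A] [IsNoetherianRing A]
        [IsAdicComplete (maximalIdeal A) A],
        ringKrullDim A = 3 → CharP (ResidueField A) p → CPLocalUniformization A)
    (hLU2 : ∀ (A : Type) [CommRing A] [IsDomain A] [IsLocalRing A] [IsNoetherianRing A]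
        [IsAdicComplete (maximalIdeal A) A],
        ringKrullDim A ≤ 2 → CharP (ResidueField A) p → CPLocalUniformization A)
    (k : Type) [Field k] [CharP k p] : ResolutionOverUpToDim.{0} k 3 :=
  CossartPiltant2019Patching_holds k (cossartJannsenSaito2020_of_embedded hCJSE k)
    (localUniformization3_of_stub1_of_luComplete_charP p hp hCJSE hLU3 hLU2 k)

/-- **Local uniformization in dimension three over a field of characteristic `p` from the tree's per-characteristic leaves**:
`CossartPiltant2019Local` (CP 2019 Thm. 1.5, printed), `CossartPiltant2019ReductionP` (CP 2019 Prop. 4.10; in the tree a THEOREM of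
`CossartPiltant2019Local`, `CossartPiltant2019Principalization` (proved), stub 1, `hEqT`, `hEqI`:
`cossartPiltant2019ReductionP_of_embPrinted_of_equivariantLU_split`), stub 1, and `hLU2` ((LU) for complete local domains of
dimension `≤ 2`). Compared with `localUniformization3_of_stub1_of_leaves_charP` (hand-1 g17) the hypothesis `hhead` is GONE.
[cite: CossartPiltant2019, Thm. 1.5, Props. 4.8, 4.10] [cite: CossartJannsenSaito2020, Thm. 1.4, Cor. 1.5] -/
theorem localUniformization3_of_stub1_of_reductionP_charP (p : ℕ) (hp : p.Prime)
    (hloc : CossartPiltant2019Local.{0}) (hRedP : CossartPiltant2019ReductionP.{0})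
    (hCJSE : CossartJannsenSaito2020Embedded.{0})
    (hLU2 : ∀ (A : Type) [CommRing A] [IsDomain A] [IsLocalRing A] [IsNoetherianRing A]
        [IsAdicComplete (maximalIdeal A) A],
        ringKrullDim A ≤ 2 → CharP (ResidueField A) p → CPLocalUniformization A)
    (k : Type) [Field k] [CharP k p] : LocalUniformization3 k :=
  localUniformization3_of_stub1_of_luComplete_charP p hp hCJSE
    (fun A _ _ _ _ _ hdim hchar => hRedP hloc p hp A hdim hchar) hLU2 k

/-- **Weak resolution of threefolds over a field of characteristic `p` from the tree's per-characteristic leaves** — the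
`k`-instance of F-02 `CossartPiltant2019` from `CossartPiltant2019Local`, `CossartPiltant2019ReductionP`, stub 1 and `hLU2`, by
the proved patching. [cite: CossartPiltant2019, Thm. 1.1, Thm. 1.5, Props. 4.6, 4.8, 4.10] [cite: CossartJannsenSaito2020, Thm. 1.2, Thm. 1.4] -/
theorem resolutionOverUpToDim_three_of_stub1_of_reductionP_charP (p : ℕ) (hp : p.Prime)
    (hloc : CossartPiltant2019Local.{0}) (hRedP : CossartPiltant2019ReductionP.{0})
    (hCJSE : CossartJannsenSaito2020Embedded.{0})
    (hLU2 : ∀ (A : Type) [CommRing A] [IsDomain A] [IsLocalRing A] [IsNoetherianRing A]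
        [IsAdicComplete (maximalIdeal A) A],
        ringKrullDim A ≤ 2 → CharP (ResidueField A) p → CPLocalUniformization A)
    (k : Type) [Field k] [CharP k p] : ResolutionOverUpToDim.{0} k 3 :=
  CossartPiltant2019Patching_holds k (cossartJannsenSaito2020_of_embedded hCJSE k)
    (localUniformization3_of_stub1_of_reductionP_charP p hp hloc hRedP hCJSE hLU2 k)

end Summit.ResolutionOfSingularities.ResolutionOfSingularities.Theorems.RadicialJung.CleanModels

end
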